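import Mathlib
import Literature.NumberTheory.LFunctions.Zhang2022.Section17Phi3plusLine
import HarnessLib

/-!
# Zhang (2022) §17 p. 96, the size bookkeeping behind "by trivial estimation … `o(p)`":
# `Σ_m |ν*(m)| m^{−3/2} ≪ 1` and `Σ_{n≤D⁴} |ν(n)| √n ≤ D¹⁰`, kernel-checked

Topic `Literature/NumberTheory/LFunctions/Zhang2022` (Landau–Siegel audit tree; verdict-neutral).
Y. Zhang, *Discrete mean estimates and the Landau–Siegel zero*, arXiv:2211.02515v1 (2022)
[Zhang2022LandauSiegel] — **an unrefereed manuscript under adjudication** (cell siegel-zhang, D-0069).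
Companion of `Section17Phi3plusLine.lean` / `Section17Phi3plusTermByTerm.lean`: the explicit error of
`Z22:§17.u005` and the off-diagonal bound of (17.3) [§17 p. 96, tex L4722–4728] carry the two factors
`A₀ = Σ_m |ν*(m)| m^{−3/2}` and `B₀ = Σ_{n≤D⁴} |ν(n)|√n`. The manuscript's "trivial estimation" is that
these are harmless: PROVED here (UNCONDITIONAL, 0 new facts),

* `tsum_norm_term_convolution_le` — the tool: for sequences `f, g` and real `σ`,
  `Σ_n ‖term (f∗g) σ n‖ ≤ (Σ_n ‖term f σ n‖)(Σ_n ‖term g σ n‖)` (Dirichlet convolution is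
  submultiplicative in the weighted `ℓ¹` norm; Mathlib's `LSeries_convolution'` on the majorants);
* `tsum_norm_term_nuStar_le` — **`A₀ ≤ (1+|ι₂|)(|ι₃|+|ι₄|)·Z⁸`**, `Z = Σ_{n≥1} n^{−3/2}` (`= ζ(3/2)`),
  for every modulus `D` with `log D ≥ 2`: `ν* = κ₂ ∗ (bχ) ∗ υ·[≤D⁴] ∗ nN_{β₂} ∗ nN_{β₃}` (t6's `nuStar`),
  `κ₂ = n^{−β₁} ∗ μ`, `b = (ϰ₁[<P^{1/2}] + ι₂ϰ₂) ∗ (ῑ₃ϰ₃ + ῑ₄ϰ₂)`, `υ = μ ∗ μχ`, each factor of modulus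
  `≤ 1` (`|n^{−β}| = 1`, `|μ| ≤ 1`, `|ϰ_i| ≤ 1` by `Skeleton.norm_vk*_le`, `0 ≤ g* ≤ 1`) up to the `ι`'s;
* `sum_norm_nu_mul_sqrt_le` — **`B₀ ≤ D¹⁰`** (`|ν(n)| ≤ τ(n) ≤ n`, `√n ≤ D²` for `n ≤ D⁴`).

With these, the error of `Z22:§17.u005` is `≤ (p−2)·C·D¹⁰·e^{1/(4𝓛⁸⁰⁰)}e^{−𝓛¹⁰/4} = O(e^{−c𝓛¹⁰})` and the
off-diagonal of (17.3) is `O(D¹⁰) = o(p)` for `p ∼ P = e^{𝓛⁹}` — the manuscript's claims, now explicit.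
Nothing here bears on Theorems 1–2 of the source or on the cell's verdict.

## References

* Y. Zhang, arXiv:2211.02515v1 (2022), §17 p. 96 ("By trivial estimation"), (17.3).
  [cite: Zhang2022LandauSiegel, §17 p. 96; §17 (17.3)]
-/

noncomputable section

open Complex Real ComplexConjugate

namespace Literature.NumberTheory.LFunctions.Zhang2022.Phi3TermByTerm

open Literature.NumberTheory.LFunctions.Zhang2022
open Literature.NumberTheory.LFunctions.Zhang2022.Skeleton
open Literature.NumberTheory.LFunctions.Zhang2022.Typed.Section17
open scoped LSeries.notation

/-! ## The weighted `ℓ¹` norm is submultiplicative under Dirichlet convolution -/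

/-- For real `σ`, the majorant sequence `n ↦ ‖term f σ n‖`, cast to `ℂ`, is itself an `LSeries.term`
sequence: `(‖term f σ n‖ : ℂ) = term (‖f ·‖) σ n`. [folklore] -/
private theorem ofReal_norm_term (f : ℕ → ℂ) (σ : ℝ) (n : ℕ) :
    ((‖LSeries.term f (σ : ℂ) n‖ : ℝ) : ℂ) = LSeries.term (fun n => ((‖f n‖ : ℝ) : ℂ)) (σ : ℂ) n := by
  rcases eq_or_ne n 0 with rfl | hn
  · simp [LSeries.term_zero]
  have hn' : (0 : ℝ) < n := Nat.cast_pos.mpr (Nat.pos_of_ne_zero hn)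
  rw [LSeries.norm_term_eq, if_neg hn, ofReal_re, LSeries.term_of_ne_zero hn,
    show ((n : ℂ) ^ (σ : ℂ)) = (((n : ℝ) ^ σ : ℝ) : ℂ) by
      rw [Complex.ofReal_cpow hn'.le]; simp]
  push_cast
  rfl

/-- **Submultiplicativity**: for real `σ` and sequences `f, g` whose `L`-series converge absolutely at
`σ`, the series of `f ∗ g` does too and `Σ_n ‖term (f∗g) σ n‖ ≤ (Σ_n‖term f σ n‖)(Σ_n‖term g σ n‖)`.
[cite: Zhang2022LandauSiegel, §17 p. 96 ("By trivial estimation")] -/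
theorem tsum_norm_term_convolution_le (f g : ℕ → ℂ) (σ : ℝ)
    (hf : LSeriesSummable f (σ : ℂ)) (hg : LSeriesSummable g (σ : ℂ)) :
    Summable (fun n => ‖LSeries.term (f ⍟ g) (σ : ℂ) n‖) ∧
    ∑' n : ℕ, ‖LSeries.term (f ⍟ g) (σ : ℂ) n‖
      ≤ (∑' n : ℕ, ‖LSeries.term f (σ : ℂ) n‖) * (∑' n : ℕ, ‖LSeries.term g (σ : ℂ) n‖) := by
  -- the majorant sequences
  set F : ℕ → ℂ := fun n => ((‖f n‖ : ℝ) : ℂ) with hF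
  set G : ℕ → ℂ := fun n => ((‖g n‖ : ℝ) : ℂ) with hG
  have hFs : LSeriesSummable F (σ : ℂ) := by
    have : Summable fun n => ((‖LSeries.term f (σ : ℂ) n‖ : ℝ) : ℂ) :=
      (Complex.summable_ofReal.mpr (summable_norm_iff.mpr hf))
    refine this.congr fun n => ofReal_norm_term f σ n
  have hGs : LSeriesSummable G (σ : ℂ) := by
    have : Summable fun n => ((‖LSeries.term g (σ : ℂ) n‖ : ℝ) : ℂ) :=
      (Complex.summable_ofReal.mpr (summable_norm_iff.mpr hg))
    refine this.congr fun n => ofReal_norm_term g σ n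
  -- termwise: `‖term (f∗g) σ n‖ ≤ Re (term (F∗G) σ n)` and the latter is real
  have hw : ∀ n, ((‖LSeries.term (F ⍟ G) (σ : ℂ) n‖ : ℝ) : ℂ) = LSeries.term (F ⍟ G) (σ : ℂ) n ∧
      ‖LSeries.term (f ⍟ g) (σ : ℂ) n‖ ≤ ‖LSeries.term (F ⍟ G) (σ : ℂ) n‖ := by
    intro n
    have e : LSeries.term (F ⍟ G) (σ : ℂ) n
        = ∑ q ∈ n.divisorsAntidiagonal, ((‖LSeries.term f (σ : ℂ) q.1‖ * ‖LSeries.term g (σ : ℂ) q.2‖ : ℝ) : ℂ) := by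
      rw [LSeries.term_convolution]
      refine Finset.sum_congr rfl fun q _ => ?_
      rw [← ofReal_norm_term, ← ofReal_norm_term]; push_cast; ring
    have hre : LSeries.term (F ⍟ G) (σ : ℂ) n
        = ((∑ q ∈ n.divisorsAntidiagonal, ‖LSeries.term f (σ : ℂ) q.1‖ * ‖LSeries.term g (σ : ℂ) q.2‖ : ℝ) : ℂ) := by
      rw [e]; push_cast; rfl
    have hnn : 0 ≤ ∑ q ∈ n.divisorsAntidiagonal, ‖LSeries.term f (σ : ℂ) q.1‖ * ‖LSeries.term g (σ : ℂ) q.2‖ :=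
      Finset.sum_nonneg fun q _ => mul_nonneg (norm_nonneg _) (norm_nonneg _)
    constructor
    · rw [hre, Complex.norm_real, Real.norm_of_nonneg hnn]
    · rw [hre, Complex.norm_real, Real.norm_of_nonneg hnn, LSeries.term_convolution]
      refine (norm_sum_le _ _).trans (le_of_eq (Finset.sum_congr rfl fun q _ => ?_))
      rw [norm_mul]
  have hFG : LSeriesSummable (F ⍟ G) (σ : ℂ) := hFs.convolution hGs
  have hsumW : Summable fun n => ‖LSeries.term (F ⍟ G) (σ : ℂ) n‖ := summable_norm_iff.mpr hFG
  have hsum : Summable fun n => ‖LSeries.term (f ⍟ g) (σ : ℂ) n‖ :=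
    Summable.of_nonneg_of_le (fun n => norm_nonneg _) (fun n => (hw n).2) hsumW
  refine ⟨hsum, ?_⟩
  -- the product formula for the majorants
  have hprod : LSeries (F ⍟ G) (σ : ℂ) = LSeries F (σ : ℂ) * LSeries G (σ : ℂ) :=
    LSeries_convolution' hFs hGs
  have hLF : LSeries F (σ : ℂ) = ((∑' n : ℕ, ‖LSeries.term f (σ : ℂ) n‖ : ℝ) : ℂ) := by
    rw [LSeries, Complex.ofReal_tsum]; exact tsum_congr fun n => (ofReal_norm_term f σ n).symm
  have hLG : LSeries G (σ : ℂ) = ((∑' n : ℕ, ‖LSeries.term g (σ : ℂ) n‖ : ℝ) : ℂ) := by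
    rw [LSeries, Complex.ofReal_tsum]; exact tsum_congr fun n => (ofReal_norm_term g σ n).symm
  have hLW : LSeries (F ⍟ G) (σ : ℂ) = ((∑' n : ℕ, ‖LSeries.term (F ⍟ G) (σ : ℂ) n‖ : ℝ) : ℂ) := by
    rw [LSeries, Complex.ofReal_tsum]; exact tsum_congr fun n => (hw n).1.symm
  have hval : ∑' n : ℕ, ‖LSeries.term (F ⍟ G) (σ : ℂ) n‖
      = (∑' n : ℕ, ‖LSeries.term f (σ : ℂ) n‖) * (∑' n : ℕ, ‖LSeries.term g (σ : ℂ) n‖) := by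
    have := hprod
    rw [hLW, hLF, hLG, ← Complex.ofReal_mul] at this
    exact Complex.ofReal_injective this
  rw [← hval]
  exact Summable.tsum_le_tsum (fun n => (hw n).2) hsum hsumW

/-! ## Bounded sequences: `Σ_n ‖term f (3/2) n‖ ≤ K·Z`, `Z = Σ_{n≥1} n^{−3/2}` -/

/-- `Z = Σ_{n≥1} n^{−3/2}` written as the absolutely convergent `L`-series of `𝟙` at `3/2`
(`= ζ(3/2) ≈ 2.61`; only finiteness is used). [folklore] -/
private theorem summable_norm_term_one :
    Summable fun n : ℕ => ‖LSeries.term (fun _ => (1 : ℂ)) ((3 / 2 : ℝ) : ℂ) n‖ :=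
  summable_norm_iff.mpr (LSeriesSummable_one_iff.mpr (by rw [ofReal_re]; norm_num))

/-- If `|f(n)| ≤ K` for all `n ≥ 1` then `Σ‖term f (3/2) n‖ ≤ K·Z` and the series converges.
[folklore] -/
private theorem tsum_norm_term_le_of_bounded {f : ℕ → ℂ} {K : ℝ}
    (hf : ∀ n, n ≠ 0 → ‖f n‖ ≤ K) :
    LSeriesSummable f ((3 / 2 : ℝ) : ℂ) ∧
    ∑' n : ℕ, ‖LSeries.term f ((3 / 2 : ℝ) : ℂ) n‖
      ≤ K * ∑' n : ℕ, ‖LSeries.term (fun _ => (1 : ℂ)) ((3 / 2 : ℝ) : ℂ) n‖ := by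
  have hle : ∀ n, ‖LSeries.term f ((3 / 2 : ℝ) : ℂ) n‖
      ≤ K * ‖LSeries.term (fun _ => (1 : ℂ)) ((3 / 2 : ℝ) : ℂ) n‖ := by
    intro n
    rcases eq_or_ne n 0 with rfl | hn
    · simp [LSeries.term_zero]
    rw [LSeries.norm_term_eq, LSeries.norm_term_eq, if_neg hn, if_neg hn, norm_one, ← mul_div_assoc,
      mul_one]
    exact div_le_div_of_nonneg_right (hf n hn) (by positivity)
  have hmaj : Summable fun n => K * ‖LSeries.term (fun _ => (1 : ℂ)) ((3 / 2 : ℝ) : ℂ) n‖ :=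
    summable_norm_term_one.mul_left K
  have hsum : Summable fun n => ‖LSeries.term f ((3 / 2 : ℝ) : ℂ) n‖ :=
    Summable.of_nonneg_of_le (fun n => norm_nonneg _) hle hmaj
  refine ⟨summable_norm_iff.mp hsum, ?_⟩
  rw [← tsum_mul_left]
  exact Summable.tsum_le_tsum hle hsum hmaj

/-- Termwise domination transfers absolute convergence and the weighted `ℓ¹` norm. [folklore] -/
private theorem tsum_norm_term_le_of_norm_le {f g : ℕ → ℂ} (hfg : ∀ n, ‖f n‖ ≤ ‖g n‖)
    (hg : LSeriesSummable g ((3 / 2 : ℝ) : ℂ)) :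
    LSeriesSummable f ((3 / 2 : ℝ) : ℂ) ∧
    ∑' n : ℕ, ‖LSeries.term f ((3 / 2 : ℝ) : ℂ) n‖ ≤ ∑' n : ℕ, ‖LSeries.term g ((3 / 2 : ℝ) : ℂ) n‖ := by
  have hle : ∀ n, ‖LSeries.term f ((3 / 2 : ℝ) : ℂ) n‖ ≤ ‖LSeries.term g ((3 / 2 : ℝ) : ℂ) n‖ := by
    intro n
    rcases eq_or_ne n 0 with rfl | hn
    · simp [LSeries.term_zero]
    rw [LSeries.norm_term_eq, LSeries.norm_term_eq, if_neg hn, if_neg hn]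
    exact div_le_div_of_nonneg_right (hfg n) (by positivity)
  have hsg : Summable fun n => ‖LSeries.term g ((3 / 2 : ℝ) : ℂ) n‖ := summable_norm_iff.mpr hg
  have hsf : Summable fun n => ‖LSeries.term f ((3 / 2 : ℝ) : ℂ) n‖ :=
    Summable.of_nonneg_of_le (fun n => norm_nonneg _) hle hsg
  exact ⟨summable_norm_iff.mp hsf, Summable.tsum_le_tsum hle hsf hsg⟩

/-! ## The factors of `ν*` -/

variable (c' : ℝ) {D : ℕ} (χ : DirichletCharacter ℂ D)

omit χ in
/-- `|μ(n)| ≤ 1` for the integer Möbius function cast to `ℂ`. [folklore] -/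
private theorem norm_moebius_cast_le_one (n : ℕ) : ‖((ArithmeticFunction.moebius n : ℤ) : ℂ)‖ ≤ 1 := by
  rw [Complex.norm_intCast]
  exact_mod_cast ArithmeticFunction.abs_moebius_le_one

omit χ in
/-- `Re β₂ = 0` ((2.13): `β₂ = 2iα(1 + c′α𝓛)`). [cite: Zhang2022LandauSiegel, §2 (2.13)] -/
private theorem beta2_re_eq_zero : (beta2 c' D).re = 0 := by
  simp [beta2]

omit χ in
/-- `Re β₃ = 0` ((2.13): `β₃ = 3iα(1 − c′α𝓛)`). [cite: Zhang2022LandauSiegel, §2 (2.13)] -/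
private theorem beta3_re_eq_zero : (beta3 c' D).re = 0 := by
  simp [beta3]

omit χ in
/-- `0 ≤ g*(y) ≤ 1` (`g* = g` or `0`, `0 < g < 1` for `𝓛 > 0`), as a bound on the complex cast.
[cite: Zhang2022LandauSiegel, §6 p. 30] -/
private theorem norm_gstar_le_one (hℓ : 0 < ell D) (y : ℝ) : ‖(gstar D y : ℂ)‖ ≤ 1 := by
  rw [Complex.norm_real, gstar]
  split_ifs
  · rw [gW, Real.norm_of_nonneg (GaussWeight.gWeight_pos (pow_pos hℓ 30) y).le]
    exact (GaussWeight.gWeight_lt_one (pow_pos hℓ 30) y).le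
  · simp

omit χ in
/-- **`|nN(β)(n)| ≤ 1`** for purely imaginary `β` (`|n^{−β}| = 1`, `0 ≤ g* ≤ 1`).
[cite: Zhang2022LandauSiegel, §17 p. 96] -/
theorem norm_nN_le_one (hℓ : 0 < ell D) {β : ℂ} (hβ : β.re = 0) (n : ℕ) : ‖nN D β n‖ ≤ 1 := by
  rw [nN, norm_mul]
  have h2 := norm_gstar_le_one (D := D) hℓ (bigT D ^ 2 / n)
  rcases Nat.eq_zero_or_pos n with rfl | hn
  · by_cases hb : β = 0
    · subst hb
      rw [neg_zero, Complex.cpow_zero, norm_one, one_mul]; exact h2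
    · have : (-β) ≠ 0 := neg_ne_zero.mpr hb
      rw [Nat.cast_zero, Complex.zero_cpow this, norm_zero, zero_mul]; exact zero_le_one
  · rw [Complex.norm_natCast_cpow_of_pos hn, neg_re, hβ, neg_zero, Real.rpow_zero, one_mul]
    exact h2

/-! ## `A₀ = Σ_m |ν*(m)| m^{−3/2} ≪ 1` -/

/-- **"`ν*(m) ≪ τ₈(m)`-type size, in `ℓ¹` form"**: for every modulus `D` with `log D ≥ 2`,
`Σ_m |ν*(m)| m^{−3/2} ≤ (1 + |ι₂|)(|ι₃| + |ι₄|)·Z⁸`, `Z = Σ_{n≥1} n^{−3/2}` — the size fact behind the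
`O(ε)` of `Z22:§17.u005` and the `o(p)` of (17.3) ("By trivial estimation").
[cite: Zhang2022LandauSiegel, §17 p. 96 ("By trivial estimation"); §17 (17.3)] -/
theorem tsum_norm_term_nuStar_le (hD : 2 ≤ Real.log D) :
    ∑' m : ℕ, ‖LSeries.term (nuStar c' χ) (3 / 2 : ℂ) m‖
      ≤ (1 + ‖iota2‖) * (‖iota3‖ + ‖iota4‖) *
          (∑' n : ℕ, ‖LSeries.term (fun _ => (1 : ℂ)) ((3 / 2 : ℝ) : ℂ) n‖) ^ 8 := by
  have hℓ : 0 < ell D := lt_of_lt_of_le (by norm_num) (show (2 : ℝ) ≤ ell D from hD)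
  set Z : ℝ := ∑' n : ℕ, ‖LSeries.term (fun _ => (1 : ℂ)) ((3 / 2 : ℝ) : ℂ) n‖ with hZ
  have hZ0 : 0 ≤ Z := tsum_nonneg fun _ => norm_nonneg _
  have e32 : (3 / 2 : ℂ) = ((3 / 2 : ℝ) : ℂ) := by push_cast; ring
  rw [e32]
  -- the five factors
  set f1 : ℕ → ℂ := fun n => MeanSquareMajorant.kappa₂ (b1 c' D) n with hf1
  set f2 : ℕ → ℂ := fun n => bcoef D n * χ (n : ZMod D) with hf2
  set f3 : ℕ → ℂ := trunc (D ^ 4) (ups χ) with hf3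
  set f4 : ℕ → ℂ := nN D (beta2 c' D) with hf4
  set f5 : ℕ → ℂ := nN D (beta3 c' D) with hf5
  have hnu : nuStar c' χ = (((f1 ⍟ f2) ⍟ f3) ⍟ f4) ⍟ f5 := rfl
  -- bounded factors: μ, n^{−ib}, μχ, nN
  have hμ : ∀ n, n ≠ 0 → ‖((ArithmeticFunction.moebius n : ℤ) : ℂ)‖ ≤ 1 :=
    fun n _ => norm_moebius_cast_le_one n
  have hpow : ∀ n, n ≠ 0 → ‖MeanSquareMajorant.powI (b1 c' D) n‖ ≤ 1 :=
    fun n hn => (MeanSquareMajorant.norm_powI_of_pos _ (Nat.pos_of_ne_zero hn)).le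
  have hμχ : ∀ n, n ≠ 0 → ‖((ArithmeticFunction.moebius n : ℤ) : ℂ) * χ (n : ZMod D)‖ ≤ 1 := by
    intro n _
    rw [norm_mul]
    exact mul_le_one₀ (norm_moebius_cast_le_one n) (norm_nonneg _) (χ.norm_le_one _)
  obtain ⟨sμ, bμ⟩ := tsum_norm_term_le_of_bounded hμ
  obtain ⟨spow, bpow⟩ := tsum_norm_term_le_of_bounded hpow
  obtain ⟨sμχ, bμχ⟩ := tsum_norm_term_le_of_bounded hμχ
  obtain ⟨s4, b4⟩ := tsum_norm_term_le_of_bounded (K := 1)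
    (fun n _ => norm_nN_le_one (D := D) hℓ (beta2_re_eq_zero c') n)
  obtain ⟨s5, b5⟩ := tsum_norm_term_le_of_bounded (K := 1)
    (fun n _ => norm_nN_le_one (D := D) hℓ (beta3_re_eq_zero c') n)
  -- f1 = κ₂ = powI ∗ μ
  have hf1c : f1 = (fun n => MeanSquareMajorant.powI (b1 c' D) n) ⍟
      (fun n => ((ArithmeticFunction.moebius : ArithmeticFunction ℂ) n)) := by
    rw [hf1, MeanSquareMajorant.kappa₂, ArithmeticFunction.coe_mul]
  have hμ' : ∀ n, n ≠ 0 → ‖(ArithmeticFunction.moebius : ArithmeticFunction ℂ) n‖ ≤ 1 :=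
    fun n _ => norm_moebius_complex_le_one n
  obtain ⟨sμ', bμ'⟩ := tsum_norm_term_le_of_bounded hμ'
  obtain ⟨s1, b1'⟩ := tsum_norm_term_convolution_le _ _ (3 / 2 : ℝ) spow sμ'
  have hs1 : LSeriesSummable f1 ((3 / 2 : ℝ) : ℂ) := by rw [hf1c]; exact summable_norm_iff.mp s1
  have hb1 : ∑' n : ℕ, ‖LSeries.term f1 ((3 / 2 : ℝ) : ℂ) n‖ ≤ Z * Z := by
    rw [hf1c]
    refine b1'.trans ?_
    calc _ ≤ (1 * Z) * (1 * Z) := mul_le_mul bpow bμ' (tsum_nonneg fun _ => norm_nonneg _)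
          (by linarith [mul_nonneg zero_le_one hZ0])
      _ = Z * Z := by ring
  -- f2 = bχ, b = A1 ∗ A2 with |A1| ≤ 1+|ι₂|, |A2| ≤ |ι₃|+|ι₄|
  set A1 : ℕ → ℂ := fun n => (if (n : ℝ) < bigP D ^ (1 / 2 : ℝ) then vk1 D n else 0) + iota2 * vk2 D n
    with hA1
  set A2 : ℕ → ℂ := fun n => conj iota3 * vk3 D n + conj iota4 * vk2 D n with hA2
  have hA1b : ∀ n, n ≠ 0 → ‖A1 n‖ ≤ 1 + ‖iota2‖ := by
    intro n _
    refine (norm_add_le _ _).trans (add_le_add ?_ ?_)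
    · split_ifs
      · exact norm_vk1_le hD n
      · simp
    · rw [norm_mul]; exact mul_le_of_le_one_right (norm_nonneg _) (norm_vk2_le hD n)
  have hA2b : ∀ n, n ≠ 0 → ‖A2 n‖ ≤ ‖iota3‖ + ‖iota4‖ := by
    intro n _
    refine (norm_add_le _ _).trans (add_le_add ?_ ?_)
    · rw [norm_mul, Complex.norm_conj]; exact mul_le_of_le_one_right (norm_nonneg _) (norm_vk3_le hD n)
    · rw [norm_mul, Complex.norm_conj]; exact mul_le_of_le_one_right (norm_nonneg _) (norm_vk2_le hD n)
  obtain ⟨sA1, bA1⟩ := tsum_norm_term_le_of_bounded hA1b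
  obtain ⟨sA2, bA2⟩ := tsum_norm_term_le_of_bounded hA2b
  obtain ⟨sb, bb⟩ := tsum_norm_term_convolution_le A1 A2 (3 / 2 : ℝ) sA1 sA2
  have hbco : bcoef D = A1 ⍟ A2 := bcoef_eq_conv D
  have hf2le : ∀ n, ‖f2 n‖ ≤ ‖(A1 ⍟ A2) n‖ := by
    intro n
    rw [hf2, ← hbco, norm_mul]
    exact mul_le_of_le_one_right (norm_nonneg _) (χ.norm_le_one _)
  obtain ⟨s2, b2'⟩ := tsum_norm_term_le_of_norm_le hf2le (summable_norm_iff.mp sb)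
  have hb2 : ∑' n : ℕ, ‖LSeries.term f2 ((3 / 2 : ℝ) : ℂ) n‖ ≤ (1 + ‖iota2‖) * (‖iota3‖ + ‖iota4‖) * (Z * Z) := by
    refine b2'.trans (bb.trans ?_)
    calc _ ≤ ((1 + ‖iota2‖) * Z) * ((‖iota3‖ + ‖iota4‖) * Z) :=
          mul_le_mul bA1 bA2 (tsum_nonneg fun _ => norm_nonneg _) (by positivity)
      _ = _ := by ring
  -- f3 = υ·[≤ D⁴], υ = μ ∗ μχ
  have hups : ups χ = (fun n => ((ArithmeticFunction.moebius n : ℤ) : ℂ)) ⍟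
      (fun n => ((ArithmeticFunction.moebius n : ℤ) : ℂ) * χ (n : ZMod D)) := rfl
  obtain ⟨su, bu⟩ := tsum_norm_term_convolution_le _ _ (3 / 2 : ℝ) sμ sμχ
  have hf3le : ∀ n, ‖f3 n‖ ≤ ‖ups χ n‖ := by
    intro n
    simp only [hf3, trunc]
    split_ifs
    · exact le_rfl
    · simp
  obtain ⟨s3, b3'⟩ := tsum_norm_term_le_of_norm_le hf3le (by rw [hups]; exact summable_norm_iff.mp su)
  have hb3 : ∑' n : ℕ, ‖LSeries.term f3 ((3 / 2 : ℝ) : ℂ) n‖ ≤ Z * Z := by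
    refine b3'.trans ?_
    rw [hups]
    refine bu.trans ?_
    calc _ ≤ (1 * Z) * (1 * Z) := mul_le_mul bμ bμχ (tsum_nonneg fun _ => norm_nonneg _)
          (by linarith [mul_nonneg zero_le_one hZ0])
      _ = Z * Z := by ring
  -- assemble along the nesting of `nuStar`
  obtain ⟨s12, b12⟩ := tsum_norm_term_convolution_le f1 f2 (3 / 2 : ℝ) hs1 s2
  obtain ⟨s123, b123⟩ := tsum_norm_term_convolution_le _ f3 (3 / 2 : ℝ) (summable_norm_iff.mp s12) s3
  obtain ⟨s1234, b1234⟩ := tsum_norm_term_convolution_le _ f4 (3 / 2 : ℝ)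
    (summable_norm_iff.mp s123) s4
  obtain ⟨_, b12345⟩ := tsum_norm_term_convolution_le _ f5 (3 / 2 : ℝ)
    (summable_norm_iff.mp s1234) s5
  rw [hnu]
  have hnn : ∀ g : ℕ → ℂ, 0 ≤ ∑' n : ℕ, ‖LSeries.term g ((3 / 2 : ℝ) : ℂ) n‖ :=
    fun g => tsum_nonneg fun _ => norm_nonneg _
  have hK : 0 ≤ (1 + ‖iota2‖) * (‖iota3‖ + ‖iota4‖) := by positivity
  have hZZ : 0 ≤ Z * Z := mul_nonneg hZ0 hZ0
  have step1 := mul_le_mul hb1 hb2 (hnn _) hZZ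
  have step2 := mul_le_mul (b12.trans step1) hb3 (hnn _)
    (mul_nonneg hZZ (mul_nonneg hK hZZ))
  have step3 := mul_le_mul (b123.trans step2) b4 (hnn _)
    (mul_nonneg (mul_nonneg hZZ (mul_nonneg hK hZZ)) hZZ)
  have step4 := mul_le_mul (b1234.trans step3) b5 (hnn _)
    (mul_nonneg (mul_nonneg (mul_nonneg hZZ (mul_nonneg hK hZZ)) hZZ) (by rw [one_mul]; exact hZ0))
  refine (b12345.trans step4).trans (le_of_eq ?_)
  ring

/-! ## `B₀ = Σ_{n≤D⁴} |ν(n)|√n ≤ D¹⁰` -/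

/-- **`Σ_{1≤n≤D⁴} |ν(n)|√n ≤ D¹⁰`** (`|ν(n)| = |Σ_{d∣n}χ(d)| ≤ τ(n) ≤ n ≤ D⁴` and `√n ≤ D²`).
[cite: Zhang2022LandauSiegel, §17 p. 96 ("By trivial estimation"); §3 (3.1)] -/
theorem sum_norm_nu_mul_sqrt_le :
    ∑ n ∈ Finset.Icc 1 (D ^ 4), ‖nu χ n‖ * Real.sqrt n ≤ (D : ℝ) ^ 10 := by
  have hterm : ∀ n ∈ Finset.Icc 1 (D ^ 4), ‖nu χ n‖ * Real.sqrt n ≤ (D : ℝ) ^ 4 * (D : ℝ) ^ 2 := by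
    intro n hn
    have hnD : n ≤ D ^ 4 := (Finset.mem_Icc.mp hn).2
    have hnD' : (n : ℝ) ≤ (D : ℝ) ^ 4 := by exact_mod_cast hnD
    have h1 : ‖nu χ n‖ ≤ (D : ℝ) ^ 4 := by
      refine (norm_divisorSumChar_le χ n).trans ?_
      exact_mod_cast (Nat.card_divisors_le_self n).trans hnD
    have h2 : Real.sqrt n ≤ (D : ℝ) ^ 2 := by
      rw [show (D : ℝ) ^ 2 = Real.sqrt ((D : ℝ) ^ 4) by
        rw [show (D : ℝ) ^ 4 = ((D : ℝ) ^ 2) ^ 2 by ring, Real.sqrt_sq (by positivity)]]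
      exact Real.sqrt_le_sqrt hnD'
    exact mul_le_mul h1 h2 (Real.sqrt_nonneg _) (by positivity)
  calc ∑ n ∈ Finset.Icc 1 (D ^ 4), ‖nu χ n‖ * Real.sqrt n
      ≤ ∑ n ∈ Finset.Icc 1 (D ^ 4), (D : ℝ) ^ 4 * (D : ℝ) ^ 2 := Finset.sum_le_sum hterm
    _ = (D ^ 4 : ℕ) * ((D : ℝ) ^ 4 * (D : ℝ) ^ 2) := by
        rw [Finset.sum_const, Nat.card_Icc, nsmul_eq_mul]; norm_num
    _ = (D : ℝ) ^ 10 := by push_cast; ring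

end Literature.NumberTheory.LFunctions.Zhang2022.Phi3TermByTerm
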